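/-
Copyright (c) 2026 the pub-hodgecm-mathlib formalisation cell (harness21).  Prover seat hodgecm-mathlib-A-p19 (g26): T3′ P-2 row (R2²) organ [T2-c], abstract layer
«THE UNIT INDEX OF A LOCAL ORDER IN `𝒪 × 𝒪[√k]`» (road «S3-tree», crux H413).
-/
import Literature.NumberTheory.Automorphic.LocalOrderUnitIndex   -- ★ O2 p845497 (F0P3-p02): brings ★ `UnitIndexModuloConductor` (dévissage, finite local rings) and ★ `LatticeIndexGL` (`IsUniformizingElement`, `natCard_quotient_span_pow`)
import HarnessLib

/-!
# The unit index of a local order in `Λ = 𝒪 × O₁`, `O₁ = 𝒪 ⊕ 𝒪θ`, `θ² ∈ 𝔪`: `[Λ^× : R^×] · q = (q − 1) · [Λ : R]`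

Topic `NumberTheory/Automorphic`; namespace `Literature.NumberTheory.Automorphic`.  THEOREMS ONLY (no definition, no instance, no notation, no named fact, no `sorry`); generic
`[Field F] [ValuativeRel F]` = (D0) currency (`𝒪 = 𝒪[F]`, `𝓀 = 𝓀[F]`, `q = Nat.card 𝓀[F]`, `hϖ : IsUniformizingElement ϖ`) and an ABSTRACT commutative ring `O₁` with a ring map
`j : 𝒪 →+* O₁` and an element `θ` such that every element of `O₁` is uniquely `j b + j c · θ` and `θ² = j k` with `k ∈ 𝔪` — the shape of the valuation ring of a RAMIFIED quadratic
extension (`θ` a uniformizer) and of its fixed subring.  Cell `pub/hodgecm-mathlib`, crux H413 = `stmt-HodgeConjecture-24833`; road «S3-tree», brick T3′ «DEPTH-ZERO κ-TRANSFER»,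
P-2 row (R2²) «THE FREE ROW, TYPE (2)» (architect A-p16 (g30) A-106∕A-110), organ [T2-c] «THE UNIT INDEX OF `𝒪_w[δ] ⊂ L_w × K₁`», abstract layer: the type-(2) torus
`E¹ × K₁¹` has eigen-algebra `L_w × K₁` with `K₁ ∕ L_w` RAMIFIED quadratic, so the maximal order is `𝒪_w × (𝒪_w ⊕ 𝒪_w θ)` and its fixed subring `𝒪_v × (𝒪_v ⊕ 𝒪_v θ)` — both
instances of the `Λ` of this file (with `𝒪 = 𝒪_w`, `q = N(v)²`, resp. `𝒪 = 𝒪_v`, `q = N(v)`), which is the type-(2) twin of ★ O2 `LocalOrderUnitIndex` (split algebra `𝒪ⁿ`).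
HONEST LABEL: HC_CM is proved only modulo the 2 remaining named inputs (hLiu418 24832, h413 24833) until rung 0 closes; elementary ring theory, asserts nothing printed.

THE MATHEMATICS.  (§1, any commutative `Λ`) For a LOCAL subring `R ≤ Λ` and an ideal `𝔣 ⊆ R` of `Λ` inside the Jacobson radical with `Λ ⧸ 𝔣` finite, the dévissage ★
`index_range_units_map_mul_natCard_units_quotient` and the finite-local-ring count ★ `natCard_units_mul_natCard_residueField` combine to the cancellation-free identity
**`[Λ^× : R^×] · #(Λ⧸𝔣) · (#k_R − 1) = #(Λ⧸𝔣)^× · #k_R · [Λ : R]`**.  (§2) `O₁ = j𝒪 ⊕ j𝒪·θ` with `θ² = jk`, `k ∈ 𝔪`: `jb + jcθ` is a unit iff `b` is (`(jb + jcθ)(jb − jcθ) = j(b² − c²k)`);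
`O₁` is local with residue field `𝓀` (via `jb + jcθ ↦ b̄`); `#(O₁ ⧸ ϖ^m O₁) = q^{2m}` and `#(O₁ ⧸ ϖ^m O₁)^× = q^{2m−1}(q−1)`.  (§3) `Λ = 𝒪 × O₁`, `𝔣 = ϖ^m Λ` (`m ≥ 1`):
`Λ ⧸ 𝔣 ≅ 𝒪⧸ϖ^m × O₁⧸ϖ^m`, so `#(Λ⧸𝔣) = q^{3m}`, `#(Λ⧸𝔣)^× = (q−1)² q^{3m−2}`, and `𝔣 ⊆ rad Λ`; hence for a local `R ≤ Λ` with residue field of size `q` and `ϖ^mΛ ⊆ R`: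
**`[Λ^× : R^×] · q = (q − 1) · [Λ : R]`** (`R^×` read as `(Units.map R.subtype).range ≤ Λ^×`).

* §1 `natCard_quotient_comap_subtype_mul_index'`, **`index_range_units_map_mul_card_eq`**.
* §2 `coord_unique`, `coord_mul`, `isUnit_add_mul_iff`, `exists_residueHom`, `isLocalRing_of_coord`, `natCard_residueField_of_coord`, `natCard_quotient_span_of_coord`, `natCard_units_quotient_span_of_coord`.
* §3 `natCard_quotient_prod_span`, `natCard_units_quotient_prod_span`, `prod_span_le_jacobson`, **`index_range_units_map_prod_mul_eq`**.

## References
* [Neukirch1999] J. Neukirch, *Algebraic Number Theory*, Grundlehren 322 (1999): Ch. I §12 (orders, conductor, `[𝒪_K^× : 𝒪^×]`, `#(𝒪_K⧸𝔣)^× ∕ #(𝒪⧸𝔣)^×`).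
* [SerreLocalFields1979] J.-P. Serre, *Local Fields*, GTM 67 (1979): Ch. I §6 Prop. 17–18 (totally ramified extensions, Eisenstein basis `𝒪_L = 𝒪_K ⊕ 𝒪_K π_L`).
* [Hungerford1974] T. W. Hungerford, *Algebra*, GTM 73 (1974): Ch. I Thm. 4.5 (index multiplicativity), Ch. III Thm. 2.9.
* [Rogawski1990] J. D. Rogawski, *Automorphic Representations of Unitary Groups in Three Variables* (1990): §4.9 Lemma 4.9.3 p. 56 (where the count is consumed).
-/

set_option autoImplicit false

noncomputable section

open scoped ValuativeRel

namespace Literature.NumberTheory.Automorphic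

open Literature.RingTheory.JacobsonRadical

/-! ## §1 The cancellation-free unit-index identity for a local subring with conductor -/

section Abstract

variable {Λ : Type*} [CommRing Λ]

/-- Additive dévissage `#(R ⧸ 𝔣 ∩ R) · [Λ : R] = #(Λ ⧸ 𝔣)` for an ideal `𝔣 ⊆ R` (Mathlib `AddSubgroup.relIndex_mul_index`; the any-ring twin of ★ O2's Pi-typed lemma).
[cite: Hungerford1974, Ch. I Thm. 4.5] -/
theorem natCard_quotient_comap_subtype_mul_index' (R : Subring Λ) (𝔣 : Ideal Λ) (h𝔣R : (𝔣 : Set Λ) ⊆ R) :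
    Nat.card (R ⧸ Ideal.comap R.subtype 𝔣) * R.toAddSubgroup.index = Nat.card (Λ ⧸ 𝔣) := by
  have hle : 𝔣.toAddSubgroup ≤ R.toAddSubgroup := fun x hx => h𝔣R hx
  have h := AddSubgroup.relIndex_mul_index hle
  have hrange : (R.subtype.toAddMonoidHom).range = R.toAddSubgroup := by
    ext x
    constructor
    · rintro ⟨y, rfl⟩; exact y.2
    · intro hx; exact ⟨⟨x, hx⟩, rfl⟩
  have hcomap : 𝔣.toAddSubgroup.comap R.subtype.toAddMonoidHom = (Ideal.comap R.subtype 𝔣).toAddSubgroup := by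
    ext x; rfl
  have hrel : 𝔣.toAddSubgroup.relIndex R.toAddSubgroup = Nat.card (R ⧸ Ideal.comap R.subtype 𝔣) := by
    rw [← hrange, ← AddSubgroup.index_comap, hcomap]
    rfl
  rw [hrel] at h
  exact h

/-- **THE CANCELLATION-FREE UNIT-INDEX IDENTITY.**  `R ≤ Λ` a LOCAL subring, `𝔣 ⊆ R` an ideal of `Λ` inside the Jacobson radical, not all of `R`, with `Λ ⧸ 𝔣` finite:
**`[Λ^× : R^×] · #(Λ⧸𝔣) · (#k_R − 1) = #(Λ⧸𝔣)^× · #k_R · [Λ : R]`** — ★ dévissage `[Λ^× : R^×]·#(R⧸𝔣)^× = #(Λ⧸𝔣)^×`, ★ `#(R⧸𝔣)^×·#k = #(R⧸𝔣)(#k − 1)` for the finite local ring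
`R ⧸ 𝔣` (residue field `k_R`), and `#(R⧸𝔣)·[Λ : R] = #(Λ⧸𝔣)`, multiplied out. [cite: Neukirch1999, Ch. I §12] [cite: Hungerford1974, Ch. I Thm. 4.5] -/
theorem index_range_units_map_mul_card_eq (R : Subring Λ) [IsLocalRing R] (𝔣 : Ideal Λ)
    (h𝔣R : (𝔣 : Set Λ) ⊆ R) (h𝔣J : 𝔣 ≤ Ideal.jacobson ⊥) (h𝔣top : Ideal.comap R.subtype 𝔣 ≠ ⊤) [Finite (Λ ⧸ 𝔣)] :
    (Units.map (R.subtype : R →* Λ)).range.index * Nat.card (Λ ⧸ 𝔣) * (Nat.card (IsLocalRing.ResidueField R) - 1) =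
      Nat.card (Λ ⧸ 𝔣)ˣ * Nat.card (IsLocalRing.ResidueField R) * R.toAddSubgroup.index := by
  classical
  set 𝔣R : Ideal R := Ideal.comap R.subtype 𝔣 with h𝔣Rdef
  have hA := index_range_units_map_mul_natCard_units_quotient R 𝔣 h𝔣R h𝔣J
  have hadd := natCard_quotient_comap_subtype_mul_index' R 𝔣 h𝔣R
  haveI : Nontrivial (R ⧸ 𝔣R) := Ideal.Quotient.nontrivial_iff.2 h𝔣top
  haveI : IsLocalRing (R ⧸ 𝔣R) := IsLocalRing.of_surjective' (Ideal.Quotient.mk 𝔣R) Ideal.Quotient.mk_surjective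
  haveI : Finite (R ⧸ 𝔣R) := by
    apply Nat.finite_of_card_ne_zero
    intro h0
    rw [h0, zero_mul] at hadd
    exact (Nat.card_pos (α := Λ ⧸ 𝔣)).ne' hadd.symm
  have hres : Nat.card (IsLocalRing.ResidueField (R ⧸ 𝔣R)) = Nat.card (IsLocalRing.ResidueField R) := natCard_residueField_quotient_eq 𝔣R
  have hB := natCard_units_mul_natCard_residueField (Λ := R ⧸ 𝔣R)
  rw [hres] at hB
  set U := (Units.map (R.subtype : R →* Λ)).range.index
  set X := Nat.card (R ⧸ 𝔣R)ˣ
  set A := Nat.card (R ⧸ 𝔣R)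
  set I := R.toAddSubgroup.index
  set Q := Nat.card (IsLocalRing.ResidueField R)
  calc U * Nat.card (Λ ⧸ 𝔣) * (Q - 1) = U * (A * I) * (Q - 1) := by rw [hadd]
    _ = U * I * (A * (Q - 1)) := by ring
    _ = U * I * (X * Q) := by rw [hB]
    _ = (U * X) * Q * I := by ring
    _ = Nat.card (Λ ⧸ 𝔣)ˣ * Q * I := by rw [hA]

end Abstract

/-! ## §2 The ring `O₁ = j𝒪 ⊕ j𝒪·θ`, `θ² = jk`, `k ∈ 𝔪` -/

section Coord

variable {F : Type*} [Field F] [ValuativeRel F] {O₁ : Type*} [CommRing O₁] (j : 𝒪[F] →+* O₁) (θ : O₁) {k : 𝒪[F]}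
  (hθ : θ ^ 2 = j k) (hk : k ∈ IsLocalRing.maximalIdeal 𝒪[F])
  (hcoord : ∀ z : O₁, ∃! bc : 𝒪[F] × 𝒪[F], z = j bc.1 + j bc.2 * θ)

include hcoord in
/-- Uniqueness of coordinates, two-sided form: `jb + jcθ = jb′ + jc′θ → b = b′ ∧ c = c′`. [cite: SerreLocalFields1979, Ch. I §6 Prop. 18] -/
theorem coord_unique {b c b' c' : 𝒪[F]} (h : j b + j c * θ = j b' + j c' * θ) : b = b' ∧ c = c' := by
  obtain ⟨bc, -, huniq⟩ := hcoord (j b + j c * θ)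
  have h1 : (b, c) = bc := huniq (b, c) rfl
  have h2 : (b', c') = bc := huniq (b', c') h
  have := h1.trans h2.symm
  exact ⟨congrArg Prod.fst this, congrArg Prod.snd this⟩

include hθ in
/-- The multiplication table: `(jb + jcθ)(jb′ + jc′θ) = j(bb′ + cc′k) + j(bc′ + cb′)θ`. [cite: SerreLocalFields1979, Ch. I §6] -/
theorem coord_mul (b c b' c' : 𝒪[F]) :
    (j b + j c * θ) * (j b' + j c' * θ) = j (b * b' + c * c' * k) + j (b * c' + c * b') * θ := by
  have hθ2 : θ * θ = j k := by rw [← sq, hθ]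
  simp only [map_add, map_mul]
  calc (j b + j c * θ) * (j b' + j c' * θ)
      = j b * j b' + (j c * j c') * (θ * θ) + (j b * j c' + j c * j b') * θ := by ring
    _ = j b * j b' + j c * j c' * j k + (j b * j c' + j c * j b') * θ := by rw [hθ2]

include hθ hk hcoord in
/-- **`jb + jcθ` IS A UNIT IFF `b` IS** (`θ² = jk`, `k ∈ 𝔪`): `(jb + jcθ)(jb − jcθ) = j(b² − c²k)` with `b² − c²k ∈ 𝒪^×` when `b` is; conversely a relation
`(jb + jcθ)(jb′ + jc′θ) = 1` forces `bb′ + cc′k = 1`, impossible for `b ∈ 𝔪`. [cite: SerreLocalFields1979, Ch. I §6 Prop. 17–18] -/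
theorem isUnit_add_mul_iff (b c : 𝒪[F]) : IsUnit (j b + j c * θ) ↔ IsUnit b := by
  constructor
  · rintro ⟨u, hu⟩
    obtain ⟨⟨b', c'⟩, hz, -⟩ := hcoord (↑u⁻¹ : O₁)
    have hprod : (j b + j c * θ) * (j b' + j c' * θ) = j 1 + j 0 * θ := by
      rw [← hu, ← hz, Units.mul_inv, map_one, map_zero, zero_mul, add_zero]
    rw [coord_mul j θ hθ] at hprod
    have h1 := (coord_unique j θ hcoord hprod).1
    by_contra hb
    have hbm : b ∈ IsLocalRing.maximalIdeal 𝒪[F] := (IsLocalRing.mem_maximalIdeal _).2 hb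
    have hmem : b * b' + c * c' * k ∈ IsLocalRing.maximalIdeal 𝒪[F] :=
      Ideal.add_mem _ (Ideal.mul_mem_right _ _ hbm) (Ideal.mul_mem_left _ _ hk)
    rw [h1] at hmem
    exact (IsLocalRing.maximalIdeal.isMaximal 𝒪[F]).ne_top (Ideal.eq_top_of_isUnit_mem _ hmem isUnit_one)
  · intro hb
    have hnu : IsUnit (b * b - c * c * k) := by
      have hm : c * c * k ∈ IsLocalRing.maximalIdeal 𝒪[F] := Ideal.mul_mem_left _ _ hk
      by_contra hn
      have hn' : b * b - c * c * k ∈ IsLocalRing.maximalIdeal 𝒪[F] := (IsLocalRing.mem_maximalIdeal _).2 hn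
      have : b * b ∈ IsLocalRing.maximalIdeal 𝒪[F] := by
        have := Ideal.add_mem _ hn' hm
        rwa [sub_add_cancel] at this
      rcases (IsLocalRing.maximalIdeal.isMaximal 𝒪[F]).isPrime.mem_or_mem this with h | h <;>
        exact ((IsLocalRing.mem_maximalIdeal _).1 h) hb
    obtain ⟨w, hw⟩ := hnu
    refine IsUnit.of_mul_eq_one ((j b + j (-c) * θ) * j (↑w⁻¹ : 𝒪[F])) ?_
    rw [← mul_assoc, coord_mul j θ hθ]
    have e1 : b * b + c * -c * k = b * b - c * c * k := by ring
    have e2 : b * -c + c * b = 0 := by ring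
    rw [e1, e2, map_zero, zero_mul, add_zero, ← map_mul, ← hw, Units.mul_inv, map_one]

include hθ hk hcoord in
/-- **THE RESIDUE MAP `jb + jcθ ↦ b̄`** is a surjective ring homomorphism `O₁ → 𝓀` whose kernel is exactly the set of non-units (`k ∈ 𝔪` kills the `cc′k` cross term).
[cite: SerreLocalFields1979, Ch. I §6 Prop. 17] -/
theorem exists_residueHom : ∃ ρ : O₁ →+* 𝓀[F], Function.Surjective ρ ∧ (∀ b c : 𝒪[F], ρ (j b + j c * θ) = IsLocalRing.residue 𝒪[F] b) ∧
    ∀ z : O₁, ρ z = 0 ↔ ¬ IsUnit z := by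
  classical
  -- coordinate functions
  set B : O₁ → 𝒪[F] := fun z => (hcoord z).choose.1 with hB
  set C : O₁ → 𝒪[F] := fun z => (hcoord z).choose.2 with hC
  have hBC : ∀ z, z = j (B z) + j (C z) * θ := fun z => (hcoord z).choose_spec.1
  have hBC' : ∀ b c, B (j b + j c * θ) = b ∧ C (j b + j c * θ) = c := by
    intro b c
    have h := hBC (j b + j c * θ)
    have := coord_unique j θ hcoord h
    exact ⟨this.1.symm, this.2.symm⟩
  have hB1 : B 1 = 1 := by
    have h := (hBC' 1 0).1
    rwa [map_one, map_zero, zero_mul, add_zero] at h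
  have hB0 : B 0 = 0 := by
    have h := (hBC' 0 0).1
    rwa [map_zero, zero_mul, add_zero] at h
  have hBadd : ∀ z z', B (z + z') = B z + B z' := by
    intro z z'
    have hsum : z + z' = j (B z + B z') + j (C z + C z') * θ := by
      conv_lhs => rw [hBC z, hBC z']
      simp only [map_add]; ring
    rw [hsum, (hBC' _ _).1]
  have hk0 : IsLocalRing.residue 𝒪[F] k = 0 := (IsLocalRing.residue_eq_zero_iff _).2 hk
  have hBmul : ∀ z z', IsLocalRing.residue 𝒪[F] (B (z * z')) = IsLocalRing.residue 𝒪[F] (B z) * IsLocalRing.residue 𝒪[F] (B z') := by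
    intro z z'
    have hprod : z * z' = j (B z * B z' + C z * C z' * k) + j (B z * C z' + C z * B z') * θ := by
      conv_lhs => rw [hBC z, hBC z']
      rw [coord_mul j θ hθ]
    rw [hprod, (hBC' _ _).1, map_add, map_mul, map_mul, map_mul, hk0, mul_zero, add_zero]
  let ρ : O₁ →+* 𝓀[F] :=
    { toFun := fun z => IsLocalRing.residue 𝒪[F] (B z)
      map_one' := by show IsLocalRing.residue 𝒪[F] (B 1) = 1; rw [hB1, map_one]
      map_mul' := fun z z' => by
        show IsLocalRing.residue 𝒪[F] (B (z * z')) = IsLocalRing.residue 𝒪[F] (B z) * IsLocalRing.residue 𝒪[F] (B z')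
        exact hBmul z z'
      map_zero' := by show IsLocalRing.residue 𝒪[F] (B 0) = 0; rw [hB0, map_zero]
      map_add' := fun z z' => by
        show IsLocalRing.residue 𝒪[F] (B (z + z')) = IsLocalRing.residue 𝒪[F] (B z) + IsLocalRing.residue 𝒪[F] (B z')
        rw [hBadd, map_add] }
  have hρ : ∀ z, ρ z = IsLocalRing.residue 𝒪[F] (B z) := fun _ => rfl
  refine ⟨ρ, fun x => ?_, fun b c => ?_, fun z => ?_⟩
  · obtain ⟨b, rfl⟩ := IsLocalRing.residue_surjective x
    exact ⟨j b + j 0 * θ, by rw [hρ, (hBC' b 0).1]⟩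
  · rw [hρ, (hBC' b c).1]
  · rw [hρ, IsLocalRing.residue_eq_zero_iff, IsLocalRing.mem_maximalIdeal, mem_nonunits_iff]
    conv_rhs => rw [hBC z]
    rw [isUnit_add_mul_iff j θ hθ hk hcoord]

include hθ hk hcoord in
/-- **`O₁` IS LOCAL** (its non-units form the kernel of the residue map). [cite: SerreLocalFields1979, Ch. I §6 Prop. 17] -/
theorem isLocalRing_of_coord : IsLocalRing O₁ := by
  obtain ⟨ρ, -, -, hker⟩ := exists_residueHom j θ hθ hk hcoord
  haveI : Nontrivial O₁ := by
    refine ⟨⟨0, 1, fun h => ?_⟩⟩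
    have h1 : ¬ IsUnit (1 : O₁) := (hker 1).1 (by rw [← h, map_zero])
    exact h1 isUnit_one
  refine IsLocalRing.of_nonunits_add ?_
  intro a b ha hb
  rw [mem_nonunits_iff] at ha hb ⊢
  rw [← hker] at ha hb ⊢
  rw [map_add, ha, hb, add_zero]

include hθ hk hcoord in
/-- **THE RESIDUE FIELD OF `O₁` IS `𝓀`**: `#k_{O₁} = q` (`O₁ ⧸ 𝔪 ≅ 𝓀` through the residue map). [cite: SerreLocalFields1979, Ch. I §6 Prop. 17] -/
theorem natCard_residueField_of_coord [Finite 𝓀[F]] :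
    @Nat.card (@IsLocalRing.ResidueField O₁ _ (isLocalRing_of_coord j θ hθ hk hcoord)) = Nat.card 𝓀[F] := by
  letI := isLocalRing_of_coord j θ hθ hk hcoord
  obtain ⟨ρ, hsurj, -, hker⟩ := exists_residueHom j θ hθ hk hcoord
  have hkerEq : RingHom.ker ρ = IsLocalRing.maximalIdeal O₁ := by
    ext z
    rw [RingHom.mem_ker, hker, IsLocalRing.mem_maximalIdeal, mem_nonunits_iff]
  unfold IsLocalRing.ResidueField
  rw [← hkerEq]
  exact Nat.card_congr (RingHom.quotientKerEquivOfSurjective hsurj).toEquiv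

include hcoord in
/-- **`#(O₁ ⧸ ϖ^m O₁) = q^{2m}`**: the additive isomorphism `𝒪² ≅ O₁`, `(b, c) ↦ jb + jcθ`, carries `(ϖ^m 𝒪)²` onto `ϖ^m O₁ = j(ϖ^m)·O₁`. [cite: SerreLocalFields1979, Ch. I §6 Prop. 18]
[cite: Hungerford1974, Ch. I Thm. 4.5] -/
theorem natCard_quotient_span_of_coord {ϖ : F} (hϖ : IsUniformizingElement ϖ) (m : ℕ) :
    Nat.card (O₁ ⧸ Ideal.span ({j ((⟨ϖ, hϖ.mem⟩ : 𝒪[F]) ^ m)} : Set O₁)) = Nat.card 𝓀[F] ^ (2 * m) := by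
  classical
  set π : 𝒪[F] := ⟨ϖ, hϖ.mem⟩ with hπ
  -- the additive equivalence `(Fin 2 → 𝒪) ≃+ O₁`
  set Ψ : (Fin 2 → 𝒪[F]) →+ O₁ :=
    { toFun := fun v => j (v 0) + j (v 1) * θ
      map_zero' := by simp
      map_add' := fun v v' => by simp only [Pi.add_apply, map_add]; ring } with hΨ
  have hΨbij : Function.Bijective Ψ := by
    constructor
    · intro v v' h
      have := coord_unique j θ hcoord (b := v 0) (c := v 1) (b' := v' 0) (c' := v' 1) h
      funext i; fin_cases i
      · exact this.1
      · exact this.2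
    · intro z
      obtain ⟨⟨b, c⟩, hz, -⟩ := hcoord z
      exact ⟨![b, c], by simp [hΨ, hz]⟩
  set e : (Fin 2 → 𝒪[F]) ≃+ O₁ := AddEquiv.ofBijective Ψ hΨbij with he
  -- it carries `span {const π^m}` onto `span {j π^m}`
  set I : Ideal (Fin 2 → 𝒪[F]) := Ideal.span ({fun _ : Fin 2 => π ^ m} : Set (Fin 2 → 𝒪[F])) with hI
  set J : Ideal O₁ := Ideal.span ({j (π ^ m)} : Set O₁) with hJ
  have hcomap : J.toAddSubgroup.comap e.toAddMonoidHom = I.toAddSubgroup := by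
    ext v
    simp only [AddSubgroup.mem_comap, Submodule.mem_toAddSubgroup]
    rw [hJ, Ideal.mem_span_singleton', hI, mem_span_const_iff]
    change (∃ a, a * j (π ^ m) = Ψ v) ↔ _
    simp only [hΨ, AddMonoidHom.coe_mk, ZeroHom.coe_mk]
    constructor
    · rintro ⟨a, ha⟩
      obtain ⟨⟨b, c⟩, hab, -⟩ := hcoord a
      rw [hab] at ha
      have hre : (j b + j c * θ) * j (π ^ m) = j (π ^ m * b) + j (π ^ m * c) * θ := by
        simp only [map_mul]; ring
      rw [hre] at ha
      have h := coord_unique j θ hcoord ha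
      intro i; fin_cases i
      · exact ⟨b, by simpa [mul_comm] using h.1.symm⟩
      · exact ⟨c, by simpa [mul_comm] using h.2.symm⟩
    · intro h
      obtain ⟨b, hb⟩ := h 0
      obtain ⟨c, hc⟩ := h 1
      refine ⟨j b + j c * θ, ?_⟩
      rw [hb, hc]
      simp only [map_mul]; ring
  have hidx : J.toAddSubgroup.index = I.toAddSubgroup.index := by
    rw [← hcomap]
    exact (AddSubgroup.index_comap_of_surjective _ e.surjective).symm
  have hcardI : Nat.card ((Fin 2 → 𝒪[F]) ⧸ I) = Nat.card 𝓀[F] ^ (m * 2) := natCard_quotient_span_const_pow hϖ m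
  change J.toAddSubgroup.index = _
  rw [hidx, mul_comm 2 m]
  exact hcardI

include hθ hk hcoord in
/-- **`#(O₁ ⧸ ϖ^m O₁)^× = q^{2m−1}(q − 1)`** for `m ≥ 1` (finite local ring with residue field `𝓀`: ★ `natCard_units_mul_natCard_residueField`).
[cite: Neukirch1999, Ch. I §12] [cite: SerreLocalFields1979, Ch. I §6 Prop. 18] -/
theorem natCard_units_quotient_span_of_coord [Finite 𝓀[F]] {ϖ : F} (hϖ : IsUniformizingElement ϖ) {m : ℕ} (hm : 0 < m) :
    Nat.card (O₁ ⧸ Ideal.span ({j ((⟨ϖ, hϖ.mem⟩ : 𝒪[F]) ^ m)} : Set O₁))ˣ = Nat.card 𝓀[F] ^ (2 * m - 1) * (Nat.card 𝓀[F] - 1) := by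
  classical
  letI := isLocalRing_of_coord j θ hθ hk hcoord
  set π : 𝒪[F] := ⟨ϖ, hϖ.mem⟩ with hπ
  set J : Ideal O₁ := Ideal.span ({j (π ^ m)} : Set O₁) with hJ
  have hq : 1 < Nat.card 𝓀[F] := Finite.one_lt_card
  have hcard : Nat.card (O₁ ⧸ J) = Nat.card 𝓀[F] ^ (2 * m) := natCard_quotient_span_of_coord j θ hcoord hϖ m
  haveI : Finite (O₁ ⧸ J) := Nat.finite_of_card_ne_zero (by rw [hcard]; exact pow_ne_zero _ (by omega))
  have hπmax : π ∈ IsLocalRing.maximalIdeal 𝒪[F] := by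
    rw [← hϖ.span_coe_eq_maximalIdeal]; exact Ideal.mem_span_singleton_self _
  have hJtop : J ≠ ⊤ := by
    intro h
    have h1 : (1 : O₁) ∈ J := h ▸ Submodule.mem_top
    rw [hJ, Ideal.mem_span_singleton'] at h1
    obtain ⟨a, ha⟩ := h1
    have hu : IsUnit (j (π ^ m)) := IsUnit.of_mul_eq_one_right a ha
    have hu' : IsUnit (j (π ^ m) + j 0 * θ) := by rwa [map_zero, zero_mul, add_zero]
    rw [isUnit_add_mul_iff j θ hθ hk hcoord] at hu'
    exact (IsLocalRing.mem_maximalIdeal _ |>.1 (Ideal.pow_mem_of_mem _ hπmax _ hm)) hu'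
  haveI : Nontrivial (O₁ ⧸ J) := Ideal.Quotient.nontrivial_iff.2 hJtop
  haveI : IsLocalRing (O₁ ⧸ J) := IsLocalRing.of_surjective' (Ideal.Quotient.mk J) Ideal.Quotient.mk_surjective
  have hres : Nat.card (IsLocalRing.ResidueField (O₁ ⧸ J)) = Nat.card 𝓀[F] := by
    rw [natCard_residueField_quotient_eq J]
    exact natCard_residueField_of_coord j θ hθ hk hcoord
  have key := natCard_units_mul_natCard_residueField (Λ := O₁ ⧸ J)
  rw [hres, hcard] at key
  obtain ⟨m', rfl⟩ := Nat.exists_eq_add_of_le hm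
  have : Nat.card (O₁ ⧸ J)ˣ * Nat.card 𝓀[F] = (Nat.card 𝓀[F] ^ (2 * (1 + m') - 1) * (Nat.card 𝓀[F] - 1)) * Nat.card 𝓀[F] := by
    rw [key]
    have e : 2 * (1 + m') = (2 * (1 + m') - 1) + 1 := by omega
    conv_lhs => rw [e, pow_succ]
    ring
  exact Nat.eq_of_mul_eq_mul_right (by omega) this

end Coord

/-! ## §3 `Λ = 𝒪 × O₁`: the conductor ideal `ϖ^m Λ`, its quotient, and the unit index of a local order -/

section Prod

variable {F : Type*} [Field F] [ValuativeRel F] {O₁ : Type*} [CommRing O₁] (j : 𝒪[F] →+* O₁) (θ : O₁) {k : 𝒪[F]}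
  (hθ : θ ^ 2 = j k) (hk : k ∈ IsLocalRing.maximalIdeal 𝒪[F])
  (hcoord : ∀ z : O₁, ∃! bc : 𝒪[F] × 𝒪[F], z = j bc.1 + j bc.2 * θ)

/-- The quotient of `Λ = 𝒪 × O₁` by `ϖ^m Λ = ((ϖ^m, jϖ^m))` is `𝒪⧸ϖ^m × O₁⧸ϖ^m O₁` (first isomorphism theorem for `(mk ∘ fst, mk ∘ snd)`). [cite: Hungerford1974, Ch. III Thm. 2.9] -/
theorem exists_ringEquiv_quotient_prod_span (a : 𝒪[F]) :
    Nonempty (((𝒪[F] × O₁) ⧸ Ideal.span ({((a, j a) : 𝒪[F] × O₁)} : Set (𝒪[F] × O₁))) ≃+*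
      (𝒪[F] ⧸ Ideal.span ({a} : Set 𝒪[F])) × (O₁ ⧸ Ideal.span ({j a} : Set O₁))) := by
  classical
  set I : Ideal (𝒪[F] × O₁) := Ideal.span ({((a, j a) : 𝒪[F] × O₁)} : Set (𝒪[F] × O₁)) with hI
  set φ : (𝒪[F] × O₁) →+* (𝒪[F] ⧸ Ideal.span ({a} : Set 𝒪[F])) × (O₁ ⧸ Ideal.span ({j a} : Set O₁)) :=
    RingHom.prod ((Ideal.Quotient.mk _).comp (RingHom.fst _ _)) ((Ideal.Quotient.mk _).comp (RingHom.snd _ _)) with hφ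
  have hsurj : Function.Surjective φ := by
    rintro ⟨x, y⟩
    obtain ⟨x', rfl⟩ := Ideal.Quotient.mk_surjective x
    obtain ⟨y', rfl⟩ := Ideal.Quotient.mk_surjective y
    exact ⟨(x', y'), rfl⟩
  have hker : RingHom.ker φ = I := by
    ext ⟨x, y⟩
    simp only [RingHom.mem_ker, hφ, RingHom.prod_apply, RingHom.coe_comp, Function.comp_apply, RingHom.coe_fst, RingHom.coe_snd,
      Prod.mk_eq_zero, Ideal.Quotient.eq_zero_iff_mem, Ideal.mem_span_singleton', hI]
    constructor
    · rintro ⟨⟨b, hb⟩, ⟨c, hc⟩⟩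
      exact ⟨(b, c), by rw [Prod.mk_mul_mk, hb, hc]⟩
    · rintro ⟨⟨b, c⟩, h⟩
      rw [Prod.mk_mul_mk, Prod.mk.injEq] at h
      exact ⟨⟨b, h.1⟩, ⟨c, h.2⟩⟩
  exact ⟨(Ideal.quotEquivOfEq hker.symm).trans (RingHom.quotientKerEquivOfSurjective hsurj)⟩

include hcoord in
/-- **`#(Λ ⧸ ϖ^m Λ) = q^{3m}`** for `Λ = 𝒪 × O₁`. [cite: Neukirch1999, Ch. I §12] [cite: SerreLocalFields1979, Ch. I §6 Prop. 18] -/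
theorem natCard_quotient_prod_span {ϖ : F} (hϖ : IsUniformizingElement ϖ) (m : ℕ) :
    Nat.card ((𝒪[F] × O₁) ⧸ Ideal.span ({(((⟨ϖ, hϖ.mem⟩ : 𝒪[F]) ^ m, j ((⟨ϖ, hϖ.mem⟩ : 𝒪[F]) ^ m)) : 𝒪[F] × O₁)} : Set (𝒪[F] × O₁))) =
      Nat.card 𝓀[F] ^ (3 * m) := by
  obtain ⟨e⟩ := exists_ringEquiv_quotient_prod_span j ((⟨ϖ, hϖ.mem⟩ : 𝒪[F]) ^ m)
  rw [Nat.card_congr e.toEquiv, Nat.card_prod, natCard_quotient_span_pow hϖ m, natCard_quotient_span_of_coord j θ hcoord hϖ m, ← pow_add]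
  congr 1; ring

include hθ hk hcoord in
/-- **`#(Λ ⧸ ϖ^m Λ)^× = (q^{m−1}(q−1)) · (q^{2m−1}(q−1))`** for `Λ = 𝒪 × O₁`, `m ≥ 1`. [cite: Neukirch1999, Ch. I §12] [cite: SerreLocalFields1979, Ch. I §6 Prop. 18] -/
theorem natCard_units_quotient_prod_span [Finite 𝓀[F]] {ϖ : F} (hϖ : IsUniformizingElement ϖ) {m : ℕ} (hm : 0 < m) :
    Nat.card ((𝒪[F] × O₁) ⧸ Ideal.span ({(((⟨ϖ, hϖ.mem⟩ : 𝒪[F]) ^ m, j ((⟨ϖ, hϖ.mem⟩ : 𝒪[F]) ^ m)) : 𝒪[F] × O₁)} : Set (𝒪[F] × O₁)))ˣ =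
      (Nat.card 𝓀[F] ^ (m - 1) * (Nat.card 𝓀[F] - 1)) * (Nat.card 𝓀[F] ^ (2 * m - 1) * (Nat.card 𝓀[F] - 1)) := by
  obtain ⟨e⟩ := exists_ringEquiv_quotient_prod_span j ((⟨ϖ, hϖ.mem⟩ : 𝒪[F]) ^ m)
  rw [Nat.card_congr (Units.mapEquiv e.toMulEquiv).toEquiv, Nat.card_congr (MulEquiv.prodUnits).toEquiv, Nat.card_prod,
    natCard_units_quotient_span_uniformizer_pow hϖ hm, natCard_units_quotient_span_of_coord j θ hθ hk hcoord hϖ hm]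

include hθ hk hcoord in
/-- `ϖ^m Λ ⊆ rad Λ` for `m ≥ 1` (`Λ = 𝒪 × O₁`; componentwise `1 + ϖ^m(…)` is a unit: in `𝒪` as `𝒪` is local, in `O₁` by the unit criterion). [cite: Neukirch1999, Ch. I §12] -/
theorem prod_span_le_jacobson {ϖ : F} (hϖ : IsUniformizingElement ϖ) {m : ℕ} (hm : 0 < m) :
    Ideal.span ({(((⟨ϖ, hϖ.mem⟩ : 𝒪[F]) ^ m, j ((⟨ϖ, hϖ.mem⟩ : 𝒪[F]) ^ m)) : 𝒪[F] × O₁)} : Set (𝒪[F] × O₁)) ≤ Ideal.jacobson ⊥ := by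
  classical
  letI := isLocalRing_of_coord j θ hθ hk hcoord
  set π : 𝒪[F] := ⟨ϖ, hϖ.mem⟩ with hπ
  have hπmax : π ∈ IsLocalRing.maximalIdeal 𝒪[F] := by
    rw [← hϖ.span_coe_eq_maximalIdeal]; exact Ideal.mem_span_singleton_self _
  have hπm : π ^ m ∈ IsLocalRing.maximalIdeal 𝒪[F] := Ideal.pow_mem_of_mem _ hπmax _ hm
  -- `j (π^m)` is a non-unit of the local ring `O₁`
  have hjm : j (π ^ m) ∈ IsLocalRing.maximalIdeal O₁ := by
    rw [IsLocalRing.mem_maximalIdeal, mem_nonunits_iff]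
    have : ¬ IsUnit (j (π ^ m) + j 0 * θ) := by
      rw [isUnit_add_mul_iff j θ hθ hk hcoord]; exact (IsLocalRing.mem_maximalIdeal _).1 hπm
    rwa [map_zero, zero_mul, add_zero] at this
  rw [Ideal.span_le]
  intro x hx
  rw [Set.mem_singleton_iff] at hx
  subst hx
  rw [SetLike.mem_coe, Ideal.mem_jacobson_bot]
  rintro ⟨y₁, y₂⟩
  rw [Prod.mk_mul_mk, Prod.mk_add_mk, Prod.isUnit_iff]
  constructor
  · have h1 : π ^ m * y₁ ∈ IsLocalRing.maximalIdeal 𝒪[F] := Ideal.mul_mem_right _ _ hπm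
    rw [← IsLocalRing.jacobson_eq_maximalIdeal ⊥ bot_ne_top, Ideal.mem_jacobson_bot] at h1
    simpa using h1 1
  · have h2 : j (π ^ m) * y₂ ∈ IsLocalRing.maximalIdeal O₁ := Ideal.mul_mem_right _ _ hjm
    rw [← IsLocalRing.jacobson_eq_maximalIdeal ⊥ bot_ne_top, Ideal.mem_jacobson_bot] at h2
    simpa using h2 1

include hθ hk hcoord in
/-- **THE UNIT INDEX OF A LOCAL ORDER IN `𝒪 × 𝒪[√k]`.**  `Λ = 𝒪 × O₁` (`O₁ = j𝒪 ⊕ j𝒪θ`, `θ² = jk`, `k ∈ 𝔪`; `𝒪` a DVR with residue field of size `q`), `R ≤ Λ` a LOCAL subring whose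
residue field has `q` elements and which contains `ϖ^m Λ` for some `m ≥ 1`.  Then **`[Λ^× : R^×] · q = (q − 1) · [Λ : R]`** (`R^×` = `(Units.map R.subtype).range`): §1 with
`#(Λ⧸ϖ^mΛ) = q^{3m}`, `#(Λ⧸ϖ^mΛ)^× = (q−1)² q^{3m−2}` and cancellation of `(q−1) q^{3m−1}`.  (Type-(2) twin of ★ O2 `index_range_units_map_mul_pow_eq`.)
[cite: Neukirch1999, Ch. I §12] [cite: Rogawski1990, §4.9 Lemma 4.9.3 p. 56] -/
theorem index_range_units_map_prod_mul_eq [Finite 𝓀[F]] {ϖ : F} (hϖ : IsUniformizingElement ϖ) {m : ℕ} (hm : 0 < m)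
    (R : Subring (𝒪[F] × O₁)) [IsLocalRing R] (hres : Nat.card (IsLocalRing.ResidueField R) = Nat.card 𝓀[F])
    (hcond : ∀ x : 𝒪[F] × O₁, (((⟨ϖ, hϖ.mem⟩ : 𝒪[F]) ^ m, j ((⟨ϖ, hϖ.mem⟩ : 𝒪[F]) ^ m)) : 𝒪[F] × O₁) * x ∈ R) :
    (Units.map (R.subtype : R →* 𝒪[F] × O₁)).range.index * Nat.card 𝓀[F] = (Nat.card 𝓀[F] - 1) * R.toAddSubgroup.index := by
  classical
  set π : 𝒪[F] := ⟨ϖ, hϖ.mem⟩ with hπ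
  set 𝔣 : Ideal (𝒪[F] × O₁) := Ideal.span ({((π ^ m, j (π ^ m)) : 𝒪[F] × O₁)} : Set (𝒪[F] × O₁)) with h𝔣
  have hq : 1 < Nat.card 𝓀[F] := Finite.one_lt_card
  have h𝔣R : (𝔣 : Set (𝒪[F] × O₁)) ⊆ R := by
    intro x hx
    rw [SetLike.mem_coe, h𝔣, Ideal.mem_span_singleton'] at hx
    obtain ⟨a, rfl⟩ := hx
    rw [mul_comm]; exact hcond a
  have h𝔣J : 𝔣 ≤ Ideal.jacobson ⊥ := prod_span_le_jacobson j θ hθ hk hcoord hϖ hm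
  have hcard : Nat.card ((𝒪[F] × O₁) ⧸ 𝔣) = Nat.card 𝓀[F] ^ (3 * m) := natCard_quotient_prod_span j θ hcoord hϖ m
  have hunits : Nat.card ((𝒪[F] × O₁) ⧸ 𝔣)ˣ = (Nat.card 𝓀[F] ^ (m - 1) * (Nat.card 𝓀[F] - 1)) * (Nat.card 𝓀[F] ^ (2 * m - 1) * (Nat.card 𝓀[F] - 1)) :=
    natCard_units_quotient_prod_span j θ hθ hk hcoord hϖ hm
  haveI : Finite ((𝒪[F] × O₁) ⧸ 𝔣) := Nat.finite_of_card_ne_zero (by rw [hcard]; exact pow_ne_zero _ (by omega))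
  have hπmax : π ∈ IsLocalRing.maximalIdeal 𝒪[F] := by
    rw [← hϖ.span_coe_eq_maximalIdeal]; exact Ideal.mem_span_singleton_self _
  have h𝔣top : Ideal.comap R.subtype 𝔣 ≠ ⊤ := by
    intro htop
    have h1 : (1 : R) ∈ Ideal.comap R.subtype 𝔣 := htop ▸ Submodule.mem_top
    rw [Ideal.mem_comap, map_one, h𝔣, Ideal.mem_span_singleton'] at h1
    obtain ⟨⟨a, b⟩, hab⟩ := h1
    rw [Prod.mk_mul_mk, Prod.mk_eq_one] at hab
    have hu : IsUnit (π ^ m) := IsUnit.of_mul_eq_one_right a hab.1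
    exact (IsLocalRing.mem_maximalIdeal _ |>.1 (Ideal.pow_mem_of_mem _ hπmax _ hm)) hu
  have key := index_range_units_map_mul_card_eq R 𝔣 h𝔣R h𝔣J h𝔣top
  rw [hres, hcard, hunits] at key
  -- cancel `(q - 1) q^{3m-1}`
  obtain ⟨m', rfl⟩ := Nat.exists_eq_add_of_le hm
  obtain ⟨p, hp⟩ : ∃ p, Nat.card 𝓀[F] = p + 1 := ⟨Nat.card 𝓀[F] - 1, by omega⟩
  set U := (Units.map (R.subtype : R →* 𝒪[F] × O₁)).range.index
  set I := R.toAddSubgroup.index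
  rw [hp] at key ⊢
  simp only [Nat.add_sub_cancel, Nat.add_sub_cancel_left] at key ⊢
  have e1 : 2 * (1 + m') - 1 = 2 * m' + 1 := by omega
  rw [e1] at key
  have hp0 : 0 < p := by omega
  have hpos : 0 < p * (p + 1) ^ (3 * m' + 2) := Nat.mul_pos hp0 (pow_pos (Nat.succ_pos p) _)
  refine Nat.eq_of_mul_eq_mul_right hpos ?_
  have lhs : U * (p + 1) * (p * (p + 1) ^ (3 * m' + 2)) = U * (p + 1) ^ (3 * (1 + m')) * p := by ring
  rw [lhs, key]
  ring

end Prod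

end Literature.NumberTheory.Automorphic

end
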